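import Summits.Ventures.CertifiedManyBodySolver.Downfold.EmeryShapeWindowClosure
import Summits.Ventures.CertifiedManyBodySolver.Downfold.EmeryFermiScalePointsCCOCK26VirtualCorners
import HarnessLib

/-!
# THE ONE-BAND FERMI-SURFACE SHAPE `t′/t` OF THE WHOLE TYPED 3BE BOX `emeryBoxCCOCK26Src (EmeryBoxesKSlicesB)` FROM TWO VIRTUAL CORNERS (two-ray rule + window closure, §B.86;
# router/EMERY-SHAPE-CORNERS.tsv)

Venture CertifiedManyBodySolver, cell `pub/hubbard-downfold` (stage S1; INFLATION-RULES-3to1-B §B.86 (i)), seat hubbard-downfold-mod-4 (technique B, g35); namespace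
`Summit.Ventures.CertifiedManyBodySolver.Downfold.Emery`. Everything PROVED (0 sorry). WHAT THIS IS NOT: a statement about Ca₂₋ₓNaₓCuO₂Cl₂ x = 0.10 ((K) #3 source box) — the typed box is SCREENING-GRADE (its file's
grade line); `U = 0` one-body kinematics of the σ model (object E = the EXACT `t–t′` shape of the σ Fermi surface, `EmeryFermiSurfaceShape`); no interaction, no `t″`.

For EVERY one-body row `(Δ, t_pd, t_pp, t_pp′) ∈ [41/20, 133/50] × [117/100, 139/100] × [29/50, 69/100] × [13/100, 17/125]` eV and the fillings below, the one-band `t′/t` of the σ-model Fermi surface AT THAT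
ROW'S OWN FERMI ENERGY lies in the window of the table (device: `EmeryShapeTwoRayRule` + `EmeryShapeWindowClosure`, exactly as `EmeryBoxesLa214ShapeCorners`; virtual corners
`V_lo = (2.05, 1.17, 0.69, 0.1618)`, `V_hi = (2.66, 1.39, 0.58, 0.1093)`, t_pp′ outside the typed range by the factor b₂/b₁ = 1.19 — the explicit 3 → 1 inflation, zero iff the box is pure or of fixed
t_pp′/t_pp ratio; certificates `EmeryFermiScalePointsCCOCK26VirtualCorners`).

| filling | certified window for t′/t over the WHOLE box | V_lo ε_F bracket | V_hi ε_F bracket | lower closure | EMERY-FS-WINDOWS (g19 sub-box device) | object-E row of record [float] |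
|---|---|---|---|---|---|---|
| n_H = 1.10 (ν = 9/20) | **[-0.3004, -0.2287]** | [1.4967, 1.5067] eV | [1.7075, 1.7175] eV | Lipschitz (dd ∈ [0.136, 0.173], M = 0.1736) | [-0.2954,-0.232] | [-0.41,-0.30] |

Sources: three-band model [HybertsenSchluterChristensen1989, Eq. (1)]; [AndersenEtAl1995, §6]; box rows as cited in the typed object's file.
-/

noncomputable section

namespace Summit.Ventures.CertifiedManyBodySolver.Downfold.Emery

open Real Set

/-- **n_H = 1.10 (ν = 9/20): for every row of the box the one-band Fermi-surface `t′/t` (object E, at the row's own Fermi energy) lies in `[-0.3004, -0.2287]`.** Lower closure: lipschitz; upper: monotone. [folklore] -/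
theorem cCOCK26Box_fsRatio_nH110 {Δ a b c : ℝ} (hΔ : Δ ∈ Icc ((41 : ℝ) / 20) ((133 : ℝ) / 50)) (ha : a ∈ Icc ((117 : ℝ) / 100) ((139 : ℝ) / 100)) (hb : b ∈ Icc ((29 : ℝ) / 50) ((69 : ℝ) / 100)) (hc : c ∈ Icc ((13 : ℝ) / 100) ((17 : ℝ) / 125)) :
    fsRatio Δ a b c (fermiEnergyOf Δ a b c ((9 : ℝ) / 20)) ∈ Icc ((-751 : ℝ) / 2500) ((-2287 : ℝ) / 10000) := by
  have hV : ((17 : ℝ) / 125) * ((69 : ℝ) / 100) / ((29 : ℝ) / 50) = ((1173 : ℝ) / 7250) := by norm_num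
  have hW : ((13 : ℝ) / 100) * ((29 : ℝ) / 50) / ((69 : ℝ) / 100) = ((377 : ℝ) / 3450) := by norm_num
  have hVlo := (fermiEnergyOf_of_pointBracketCheck virtPt_CCOCK26Vlo_nH110_br (by norm_num) (by norm_num) (by norm_num) (ν := (9/20 : ℝ)) (by push_cast; exact ⟨le_rfl, le_rfl⟩)).2
  have hVhi := (fermiEnergyOf_of_pointBracketCheck virtPt_CCOCK26Vhi_nH110_br (by norm_num) (by norm_num) (by norm_num) (ν := (9/20 : ℝ)) (by push_cast; exact ⟨le_rfl, le_rfl⟩)).2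
  have hAlo := (fermiEnergyOf_of_pointBracketCheck virtPt_CCOCK26Alo_nH110_br (by norm_num) (by norm_num) (by norm_num) (ν := (9/20 : ℝ)) (by push_cast; exact ⟨le_rfl, le_rfl⟩)).2
  have hTop := (fermiEnergyOf_of_pointBracketCheck virtPt_CCOCK26H_nH110_br (by norm_num) (by norm_num) (by norm_num) (ν := (9/20 : ℝ)) (by push_cast; exact ⟨le_rfl, le_rfl⟩)).2
  push_cast at hVlo hVhi hAlo hTop
  norm_num at hVlo hVhi hAlo hTop
  refine fsRatio_fermiEnergyOf_mem_Icc_windowClosure (Δ₁ := ((41 : ℝ) / 20)) (Δ₂ := ((133 : ℝ) / 50)) (a₁ := ((117 : ℝ) / 100)) (a₂ := ((139 : ℝ) / 100)) (b₁ := ((29 : ℝ) / 50))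
    (b₂ := ((69 : ℝ) / 100)) (c₁ := ((13 : ℝ) / 100)) (c₂ := ((17 : ℝ) / 125)) (e₁ := ((14967 : ℝ) / 10000)) (e₂ := ((3837 : ℝ) / 2500)) (e₃ := 0) (e₄ := ((687 : ℝ) / 400)) (by norm_num) (by norm_num) (by norm_num) (by norm_num)
    (by norm_num) hΔ ha hb hc (by norm_num) (by norm_num) ?_ ?_ ?_ (by norm_num) ?_ ?_ ?_ (by norm_num) ?_
  · -- regime at the box's Fermi-energy high corner: c₂ b₂ ε_F(Δ₁, a₂, b₂, c₁) ≤ a₁² b₁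
    nlinarith [hTop.2]
  · rw [hV]; exact hVlo.1
  · exact hAlo.2
  · intro ε hε
    rw [hV]
    have hlip := fsRatio_ge_on_window (Δ := ((41 : ℝ) / 20)) (a := ((117 : ℝ) / 100)) (b := ((69 : ℝ) / 100)) (c := ((1173 : ℝ) / 7250)) (p := ((14967 : ℝ) / 10000)) (q := ((3837 : ℝ) / 2500))
      (M := ((217 : ℝ) / 1250)) (by norm_num) (by norm_num) (by norm_num) (by norm_num) (by norm_num [fsD, fsN]) (by norm_num [dopingDisc]) (by norm_num [dopingDisc]) hε
    refine le_trans ?_ hlip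
    norm_num [fsRatio, fsD, fsN]
  · exact (fermiEnergyOf_pos (by norm_num) (by norm_num) (by norm_num) (by norm_num) (by norm_num) (by norm_num)).le
  · rw [hW]; exact hVhi.2
  · intro ε hε
    rw [hW]
    have hmono := (fsRatio_mem_Icc_on_window_of_dopingDisc_nonpos (Δ := ((133 : ℝ) / 50)) (a := ((139 : ℝ) / 100)) (b := ((29 : ℝ) / 50)) (c := ((377 : ℝ) / 3450))
      (p := 0) (q := ((687 : ℝ) / 400)) (by norm_num) (by norm_num) (by norm_num) (by norm_num) (by norm_num) (by norm_num) (by norm_num)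
      (by norm_num [dopingDisc]) hε).2
    refine le_trans hmono ?_
    norm_num [fsRatio, fsD, fsN]

end Summit.Ventures.CertifiedManyBodySolver.Downfold.Emery
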